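import Summits.BirchSwinnertonDyer.BirchSwinnertonDyer.Theorems.ManinLocalTwoThreeEtaUnitCubeIffThree
import Summits.BirchSwinnertonDyer.Rank1Residual.ManinAdditive.CuspidalKummerClass
import HarnessLib

/-!
# E-an-56 `EtaUnitCubeIffThree` holds BY NAME (the `p = 3` cuspidal-Kummer cube test is a theorem)

Summit `BirchSwinnertonDyer`, route `ManinLocalTwoThree` (cell bsd-f2-manin), crux C3 `ManinPrimeToThreeAtNine`
(stmt-BirchSwinnertonDyer-22968), the `W[3]`-reducible residual.  The `@[conjecture]` leaf E-an-56
`Summit.BirchSwinnertonDyer.Rank1Residual.ManinAdditive.CuspidalKummerThree.EtaUnitCubeIffThree` (typer T-an-18, p610785: «an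
`η`-unit series with exponents `r` on a finite set of scales `S ∌ 0` is a cube in `ℤ₃⟦q⟧` iff every `r_δ` is divisible by `3`»)
is PROVED by `ManinLocalTwoThree.etaUnitCubeIffThree` (`…EtaUnitCubeIffThree.lean`: `⇐` cubes of `η`-products; `⇒` the mod-`3`
coefficient functional at the scales prime to `3`, `…EtaUnitCubeNonMult.lean`, and the contraction `q³ ↦ q` at the scales in `3ℕ`,
`…EtaUnitCubeThird.lean`), whose statement is the body of the leaf with `IsEtaUnitSeries` unfolded (definitionally).  This file
records the discharge BY NAME: `etaUnitCubeIffThree_holds`.  (Twin of the typer's `CuspidalKummerClassHolds.EtaUnitSquareIffEven_holds`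
for E-an-49⁺.)  With E-an-56 a theorem, the certificate E-an-58 `ManinPrimeToThreeOfEtaExponent` is a theorem modulo E-an-55 alone
(REF1 §R50).  Nothing about BSD or Manin's conjecture is proved here.
-/

set_option autoImplicit false
-- the gate's namespace `Summit.BirchSwinnertonDyer.BirchSwinnertonDyer.…` repeats the summit name (single-conjunct summit)
set_option linter.dupNamespace false

namespace Summit.BirchSwinnertonDyer.BirchSwinnertonDyer.Theorems.ManinLocalTwoThree

/-- **E-an-56 is a theorem**: the leaf `Summit.BirchSwinnertonDyer.Rank1Residual.ManinAdditive.CuspidalKummerThree.EtaUnitCubeIffThree`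
holds BY NAME (its body is `etaUnitCubeIffThree` with `IsEtaUnitSeries` folded, definitionally). [cite: Apostol1990, §3.1–§3.2] -/
theorem etaUnitCubeIffThree_holds :
    Summit.BirchSwinnertonDyer.Rank1Residual.ManinAdditive.CuspidalKummerThree.EtaUnitCubeIffThree :=
  fun S r g hS hg => etaUnitCubeIffThree S r g hS hg


end Summit.BirchSwinnertonDyer.BirchSwinnertonDyer.Theorems.ManinLocalTwoThree
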